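import Summits.HodgeConjecture.HodgeConjecture.Theorems.R90S3UnramifiedOffPlantedPlace     -- ★ p863924 P8c (+ ★ p863812 P6 (ii) §3 local-to-global)
import Summits.HodgeConjecture.HodgeConjecture.Theorems.R90S3CompletionOfDenseEmbedding      -- ★ P1: `valued_apply_eq_valuation` (pinned valuation = pulled-back valuation)
import HarnessLib

/-!
# R90-TF · S3 · THEOREMS — `R90S3PlantedDyadicData` ((U3-F) split, brick P8d §1): the dyadic inputs of P8c from the planting when the planted prime is ODD —
# «`α ≡ 1 (mod 4)` at every dyadic place» (read through the pinning embeddings) gives a global `κ ∈ 𝓞 F′` with `α = 1 + 4κ`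

R90-TF section S3 (successor dealer R90-C12-plan (g2), deal 2026-09-05T01:03:33Z «P8d → K2E3-p21; census first; if the p-odd κ-form is XS file it at once and leave the
p = 2 ξ-CRT as §2»); crux H413 (`stmt-HodgeConjecture-24833`, lane `--supports … --as helper`), route `HCCMUnconditional`.  Feeds the `κ`-corollary
`isUnramifiedAt_of_planted_one_add_four_mul` of ★ P8c (`R90S3UnramifiedOffPlantedPlace`) inside the assembly P8 of the (U3-F) socket `stub_R90_S3_auxGlobaliseField`
(`Cruxes/H413/Lines/R90_S3_LocalTransportWaveG.lean` :645).  THIS FILE = §1 (planted prime ODD: `ξ = 1`, `x = 1`); §2 (planted prime `2`: `ξ ∈ 𝔭_{v′}^e`, `x` by CRT in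
`𝓞 F′ ∕ 4𝓞 F′`) is appended later (append protocol).  THEOREMS ONLY (no `def`, no `instance`, no notation, no named fact, no `sorry`); ★ imports only; never imports
`Cruxes/…/Lines`.

THE MATHEMATICS [Neukirch1999 Ch. I §3 (integrality is local), Ch. II (8.1); Omeara1963 §63A].  `F` a number field, `γ ∈ 𝓞 F`.  If at every DYADIC place `u` one has
`|(γ − 1)∕4|_u ≤ 1` (i.e. `γ ≡ 1 (mod 4𝒪_u)` — at a degree-one dyadic place the classes `1, 5 (mod 8)` of the planting), then `(γ − 1)∕4 ∈ 𝓞 F` (the condition is automatic off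
`2`, ★ `valuation_sub_one_div_four_le_one_of_two_not_mem`; integrality is local, ★ `exists_eq_one_add_four_mul_of_valuation_le`), i.e. `γ = 1 + 4κ` with `κ ∈ 𝓞 F`.  The local
condition is READ through a dense pinning embedding `J : F →+* L_w` of the place `u` (★ P1 `valued_apply_eq_valuation`: `|y|_u = |J y|`): `|(J γ − 1)∕4| ≤ 1` in `L_w`
suffices.  With `δ² = γ` this is exactly the input `hδ : δ² = 1 + 4κ` of ★ P8c's `κ`-corollary.
* §1 `valuation_eq_valued_apply_of_pinned` (reading a valuation through the pinning), `valuation_sub_one_div_four_le_one_of_pinned`,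
  **`exists_eq_one_add_four_mul_of_dyadic`**, **`exists_sq_eq_one_add_four_mul_of_dyadic`** (the `hδ` of P8c's `κ`-corollary),
  `isUnramifiedAt_of_planted_of_dyadic` (end-to-end: odd unit data + dyadic `≡ 1 (mod 4)` data ⇒ the socket's `hur′` clause).
* §2 (appended) `mem_span_four_of_forall_intValuation_le`, `intValuation_sub_one_le_of_valuation_div_four_le`, **`exists_planted_dyadic_data`** (CRT: the binders
  `(x m₁ ξ hξ hm₁ hx hm₁u)` of ★ P8c at any distinguished `v′`, from «`α` a unit and `≡ 1 (mod 4)` at the dyadic `u ≠ v′`»).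

HONEST LABEL: HC_CM is proved only modulo the 7 printed citations (2 remaining named inputs: hLiu418 = stmt-HodgeConjecture-24832, h413 =
stmt-HodgeConjecture-24833) until rung 0 closes; sub-brick of the GENUINE residual (U3-F); proves nothing printed; count-neutral.

## References
* [Neukirch1999] J. Neukirch, *Algebraic Number Theory* (1999), Ch. I §3, Ch. II (8.1).
* [Omeara1963] O. T. O'Meara, *Introduction to Quadratic Forms* (1963), §63A.
-/

set_option autoImplicit false
-- the mandated namespace repeats the single-problem summit's segment (`HodgeConjecture.HodgeConjecture`)
set_option linter.dupNamespace false

noncomputable section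

namespace Summit.HodgeConjecture.HodgeConjecture.R90.S3

open NumberField IsDedekindDomain
open Literature.NumberTheory.NumberFields Literature.NumberTheory.Automorphic Literature.NumberTheory.Automorphic.UnitaryGroup

/-! ## §1 Planted prime ODD: `α ≡ 1 (mod 4)` at every dyadic place ⇒ `α = 1 + 4κ` globally -/

section Pinned

variable {F : Type} [Field F] [NumberField F] {L : Type} [Field L] [NumberField L] (w : HeightOneSpectrum (𝓞 L)) (J : F →+* w.adicCompletion L)

/-- **Reading a valuation through the pinning embedding**: for a dense `J : F →+* L_w` pinning the place `u` of `F` (★ P1), `|y|_u = |J y|` for every `y ∈ F`.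
(★ `valued_apply_eq_valuation`, restated in the direction the planting consumes.) [cite: Neukirch1999, Ch. II (8.1)] -/
theorem valuation_eq_valued_apply_of_pinned (hJ : DenseRange J) {u : HeightOneSpectrum (𝓞 F)}
    (hu : ∀ x : 𝓞 F, x ∈ u.asIdeal ↔ Valued.v (J (x : F)) < 1) (y : F) : u.valuation F y = Valued.v (J y) :=
  (valued_apply_eq_valuation w J hJ hu y).symm

/-- **`γ ≡ 1 (mod 4)` at a pinned place, read in the target**: if `|(J γ − 1)∕4| ≤ 1` in `L_w` then `|(γ − 1)∕4|_u ≤ 1`. [cite: Neukirch1999, Ch. II (8.1)] -/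
theorem valuation_sub_one_div_four_le_one_of_pinned (hJ : DenseRange J) {u : HeightOneSpectrum (𝓞 F)}
    (hu : ∀ x : 𝓞 F, x ∈ u.asIdeal ↔ Valued.v (J (x : F)) < 1) (γ : F) (h : Valued.v ((J γ - 1) / 4) ≤ 1) :
    u.valuation F ((γ - 1) / 4) ≤ 1 := by
  rw [valuation_eq_valued_apply_of_pinned w J hJ hu, map_div₀, map_sub, map_one, map_ofNat]
  exact h

end Pinned

section Global

variable {F : Type} (E : Type) [Field F] [NumberField F] [Field E] [NumberField E] [Algebra F E]

omit [NumberField E] [Algebra F E] in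
/-- **`γ = 1 + 4κ` from the DYADIC data alone**: if `|(γ − 1)∕4|_u ≤ 1` at every dyadic place `u` of `F` (`γ ∈ 𝓞 F`), then `γ = 1 + 4κ` for some `κ ∈ 𝓞 F` (off `2` the condition is
automatic, ★ `valuation_sub_one_div_four_le_one_of_two_not_mem`; integrality is local, ★ `exists_eq_one_add_four_mul_of_valuation_le`). [cite: Neukirch1999, Ch. I §3] -/
theorem exists_eq_one_add_four_mul_of_dyadic (γ : 𝓞 F)
    (h : ∀ u : HeightOneSpectrum (𝓞 F), (2 : 𝓞 F) ∈ u.asIdeal → u.valuation F ((((γ : F)) - 1) / 4) ≤ 1) :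
    ∃ κ : 𝓞 F, (γ : F) = 1 + 4 * (κ : F) :=
  exists_eq_one_add_four_mul_of_valuation_le fun u => by
    by_cases h2 : (2 : 𝓞 F) ∈ u.asIdeal
    · exact h u h2
    · exact valuation_sub_one_div_four_le_one_of_two_not_mem u γ h2

omit [NumberField E] in
/-- **The `hδ` input of ★ P8c's `κ`-corollary**: with `δ² = γ` and the dyadic data, `δ² = 1 + 4κ` for some `κ ∈ 𝓞 F` with `γ = 1 + 4κ`. [cite: Neukirch1999, Ch. I §3] [cite: Omeara1963, §63A] -/
theorem exists_sq_eq_one_add_four_mul_of_dyadic (γ : 𝓞 F) {δ : E} (hδ : δ ^ 2 = algebraMap F E (γ : F))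
    (h : ∀ u : HeightOneSpectrum (𝓞 F), (2 : 𝓞 F) ∈ u.asIdeal → u.valuation F ((((γ : F)) - 1) / 4) ≤ 1) :
    ∃ κ : 𝓞 F, δ ^ 2 = 1 + 4 * algebraMap F E (κ : F) ∧ (γ : F) = 1 + 4 * (κ : F) := by
  obtain ⟨κ, hκ⟩ := exists_eq_one_add_four_mul_of_dyadic γ h
  refine ⟨κ, ?_, hκ⟩
  rw [hδ, hκ, map_add, map_one, map_mul, map_ofNat]

/-- **END-TO-END, planted prime ODD**: `E = F(δ)`, `δ² = α ∈ 𝓞 F`, `α` a unit at every odd place `u ≠ v′` and `α ≡ 1 (mod 4𝒪_u)` at every dyadic place `u` ⇒ the socket's `hur′` clause: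
`E` is unramified at every place over every finite `u ≠ v′` (★ P8c `isUnramifiedAt_of_planted_one_add_four_mul` at the `κ` of `exists_sq_eq_one_add_four_mul_of_dyadic`).
[cite: Neukirch1999, Ch. III §2 Thm. (2.6)] [cite: Omeara1963, §63A] -/
theorem isUnramifiedAt_of_planted_of_dyadic [Algebra.IsQuadraticExtension F E] (v' : HeightOneSpectrum (𝓞 F)) {δ : E} (α : 𝓞 F)
    (hδ : δ ^ 2 = algebraMap F E (α : F)) (hδF : δ ∉ (algebraMap F E).range)
    (hαu : ∀ u : HeightOneSpectrum (𝓞 F), u ≠ v' → (2 : 𝓞 F) ∉ u.asIdeal → α ∉ u.asIdeal)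
    (hα2 : ∀ u : HeightOneSpectrum (𝓞 F), (2 : 𝓞 F) ∈ u.asIdeal → u.valuation F ((((α : F)) - 1) / 4) ≤ 1) :
    ∀ u : HeightOneSpectrum (𝓞 F), u ≠ v' → ∀ W : PlacesOver E u, Algebra.IsUnramifiedAt (𝓞 F) W.1.asIdeal := by
  obtain ⟨κ, hδκ, hακ⟩ := exists_sq_eq_one_add_four_mul_of_dyadic E α hδ hα2
  have hακ' : α = 1 + 4 * κ := RingOfIntegers.ext (by
    rw [hακ]
    change _ = algebraMap (𝓞 F) F (1 + 4 * κ)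
    rw [map_add, map_one, map_mul, map_ofNat])
  exact isUnramifiedAt_of_planted_one_add_four_mul E v' κ hδκ hδF (fun u hu h2 => hακ' ▸ hαu u hu h2)

end Global

/-! ## §2 Planted prime `2` (or ANY distinguished `v′`): the auxiliary `ξ`, `x`, `m₁ = α ξ²` of ★ P8c by the Chinese remainder theorem

Appended 2026-09-05 (append protocol; §1 = ★ p863968 unchanged).  When the planted prime is `2` the radicand `α` need not be `≡ 1 (mod 4)` at the distinguished
place `v′`, so no global `κ` exists; instead choose `t ∈ 𝓞 F` with `t ≡ 0 (mod 4𝒪_{v′})` and `t ≡ 1 (mod 4𝒪_u)` at every OTHER dyadic place `u` (CRT, Mathlib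
`IsDedekindDomain.exists_forall_sub_mem_ideal`, moduli `u^{n_u}` with `(4) = ∏ u^{n_u}`), `t ≠ 0`, and put `ξ := t`, `x := t`, `m₁ := α t²`: then
`x² − m₁ = t² (1 − α) ∈ (4)` (checked place by place through the valuations: `|t|_{v′} ≤ |4|_{v′}`; `|1 − α|_u ≤ |4|_u` at the other dyadic `u`; integrality is local,
Mathlib `mem_integers_of_valuation_le_one`) and `m₁ ∉ 𝔭_u` at every dyadic `u ≠ v′` (`t ≡ 1`, `α` a unit there).  [Neukirch1999 Ch. I §3 (3.6) CRT; Omeara1963 §63A] -/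

section PlantedTwo

variable {F : Type} [Field F] [NumberField F]

/-- `|z|_u ≤ |4|_u` at EVERY finite place ⇒ `z ∈ (4)` (integrality of `z ∕ 4` is local, Mathlib `mem_integers_of_valuation_le_one`). [cite: Neukirch1999, Ch. I §3] -/
theorem mem_span_four_of_forall_intValuation_le (z : 𝓞 F)
    (h : ∀ u : HeightOneSpectrum (𝓞 F), u.intValuation z ≤ u.intValuation (4 : 𝓞 F)) : z ∈ Ideal.span {(4 : 𝓞 F)} := by
  have h4F : (4 : F) ≠ 0 := by norm_num
  have hval : ∀ u : HeightOneSpectrum (𝓞 F), u.valuation F (((z : F)) / 4) ≤ 1 := fun u => by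
    rw [map_div₀, RingOfIntegers.coe_eq_algebraMap, HeightOneSpectrum.valuation_of_algebraMap, ← map_ofNat (algebraMap (𝓞 F) F) 4,
      HeightOneSpectrum.valuation_of_algebraMap]
    have h4v : u.intValuation (4 : 𝓞 F) ≠ 0 := HeightOneSpectrum.intValuation_ne_zero u 4 (by norm_num)
    exact (div_le_one₀ (zero_lt_iff.2 h4v)).2 (h u)
  obtain ⟨κ, hκ⟩ := HeightOneSpectrum.mem_integers_of_valuation_le_one F (((z : F)) / 4) hval
  refine Ideal.mem_span_singleton.2 ⟨κ, RingOfIntegers.ext ?_⟩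
  have hκ' : (κ : F) = (z : F) / 4 := hκ
  change (z : F) = algebraMap (𝓞 F) F (4 * κ)
  rw [map_mul, map_ofNat, ← RingOfIntegers.coe_eq_algebraMap, hκ']
  field_simp

/-- At a dyadic place, `|α − 1|_u ≤ |4|_u` is the integral form of `|(α − 1)∕4|_u ≤ 1`. [cite: Neukirch1999, Ch. I §3] -/
theorem intValuation_sub_one_le_of_valuation_div_four_le (u : HeightOneSpectrum (𝓞 F)) (α : 𝓞 F)
    (h : u.valuation F ((((α : F)) - 1) / 4) ≤ 1) : u.intValuation (α - 1) ≤ u.intValuation (4 : 𝓞 F) := by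
  have h4F : (4 : F) ≠ 0 := by norm_num
  have h4v : u.valuation F (4 : F) ≠ 0 := (Valuation.ne_zero_iff _).2 h4F
  rw [map_div₀, div_le_one₀ (zero_lt_iff.2 h4v)] at h
  have hsub : ((α : F)) - 1 = algebraMap (𝓞 F) F (α - 1) := by rw [map_sub, map_one, RingOfIntegers.coe_eq_algebraMap]
  rwa [hsub, ← map_ofNat (algebraMap (𝓞 F) F) 4, HeightOneSpectrum.valuation_of_algebraMap, HeightOneSpectrum.valuation_of_algebraMap] at h

open scoped Classical in
/-- **P8d §2 — THE DYADIC DATA OF ★ P8c BY CRT** (planted prime `2`, or any distinguished `v′`).  For `α ∈ 𝓞 F` with `α ∉ 𝔭_u` and `|(α − 1)∕4|_u ≤ 1` at every dyadic `u ≠ v′`,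
there are `x, m₁, ξ ∈ 𝓞 F` with `ξ ≠ 0`, `m₁ = α ξ²`, `x² − m₁ ∈ (4)` and `m₁ ∉ 𝔭_u` at every dyadic `u ≠ v′` — the binders `(x m₁ ξ hξ hm₁ hx hm₁u)` of ★
`isUnramifiedAt_of_planted` (P8c).  Construction: `ξ = x = t`, `t ≡ 0 (mod 4𝒪_{v′})`, `t ≡ 1 (mod 4𝒪_u)` at the other dyadic `u` (CRT), `m₁ = α t²`, `x² − m₁ = t²(1 − α)`.
[cite: Neukirch1999, Ch. I §3 (3.6)] [cite: Omeara1963, §63A] -/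
theorem exists_planted_dyadic_data (v' : HeightOneSpectrum (𝓞 F)) (α : 𝓞 F)
    (hαu2 : ∀ u : HeightOneSpectrum (𝓞 F), u ≠ v' → (2 : 𝓞 F) ∈ u.asIdeal → α ∉ u.asIdeal)
    (hα4 : ∀ u : HeightOneSpectrum (𝓞 F), u ≠ v' → (2 : 𝓞 F) ∈ u.asIdeal → u.valuation F ((((α : F)) - 1) / 4) ≤ 1) :
    ∃ x m₁ ξ : 𝓞 F, ξ ≠ 0 ∧ m₁ = α * ξ ^ 2 ∧ x ^ 2 - m₁ ∈ Ideal.span {(4 : 𝓞 F)} ∧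
      ∀ u : HeightOneSpectrum (𝓞 F), u ≠ v' → (2 : 𝓞 F) ∈ u.asIdeal → m₁ ∉ u.asIdeal := by
  -- the dyadic places and the exponents `n_u` of `(4) = ∏ u^{n_u}`
  have h2ne : (Ideal.span {(2 : 𝓞 F)} : Ideal (𝓞 F)) ≠ 0 := by
    rw [Ne, Ideal.zero_eq_bot, Ideal.span_singleton_eq_bot]
    norm_num
  have h4ne : (4 : 𝓞 F) ≠ 0 := by norm_num
  set D : Finset (HeightOneSpectrum (𝓞 F)) := (Ideal.finite_factors h2ne).toFinset with hDdef
  have hD : ∀ u : HeightOneSpectrum (𝓞 F), u ∈ D ↔ (2 : 𝓞 F) ∈ u.asIdeal := fun u => by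
    rw [hDdef, Set.Finite.mem_toFinset, Set.mem_setOf_eq, Ideal.dvd_span_singleton]
  set n : HeightOneSpectrum (𝓞 F) → ℕ := fun u => (Associates.mk u.asIdeal).count (Associates.mk (Ideal.span {(4 : 𝓞 F)})).factors with hndef
  have hn4 : ∀ u : HeightOneSpectrum (𝓞 F), u.intValuation (4 : 𝓞 F) = WithZero.exp (-(n u : ℤ)) := fun u =>
    u.intValuation_if_neg h4ne
  have hmem_iff : ∀ (u : HeightOneSpectrum (𝓞 F)) (z : 𝓞 F), z ∈ u.asIdeal ^ n u ↔ u.intValuation z ≤ u.intValuation (4 : 𝓞 F) := fun u z => by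
    rw [hn4, HeightOneSpectrum.intValuation_le_pow_iff_mem]
  have h4mem : ∀ u : HeightOneSpectrum (𝓞 F), (4 : 𝓞 F) ∈ u.asIdeal ^ n u := fun u => (hmem_iff u 4).2 le_rfl
  have hnpos : ∀ u : HeightOneSpectrum (𝓞 F), (2 : 𝓞 F) ∈ u.asIdeal → u.asIdeal ^ n u ≤ u.asIdeal := fun u hu => by
    have hn0 : n u ≠ 0 := by
      intro h0
      have h41 : u.intValuation (4 : 𝓞 F) < 1 := by
        rw [HeightOneSpectrum.intValuation_lt_one_iff_mem, show (4 : 𝓞 F) = 2 * 2 by norm_num]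
        exact Ideal.mul_mem_left _ _ hu
      rw [hn4, h0] at h41
      simp at h41
    exact Ideal.pow_le_self hn0
  -- CRT: `t ≡ 0` at `v′`, `t ≡ 1` at the other dyadic places, modulo `u^{n_u}`
  obtain ⟨y, hy⟩ := IsDedekindDomain.exists_forall_sub_mem_ideal (s := D) (fun u : HeightOneSpectrum (𝓞 F) => u.asIdeal) n
    (fun u _ => u.prime) (fun u _ u' _ hne h => hne (HeightOneSpectrum.ext h)) (fun u => if (u : HeightOneSpectrum (𝓞 F)) = v' then 0 else 1)
  set t : 𝓞 F := if y = 0 then 4 else y with htdef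
  have ht0 : t ≠ 0 := by
    rw [htdef]
    split_ifs with hy0
    · exact h4ne
    · exact hy0
  have ht : ∀ u ∈ D, t - (if u = v' then 0 else 1) ∈ u.asIdeal ^ n u := fun u hu => by
    have h := hy u hu
    rw [htdef]
    split_ifs at h ⊢ with hy0 huv huv
    · rw [sub_zero]; exact h4mem u
    · rw [hy0, zero_sub] at h
      have : (4 : 𝓞 F) - 1 = 4 + (-1) := by ring
      rw [this]
      exact Ideal.add_mem _ (h4mem u) h
    · exact h
    · exact h
  -- the data
  refine ⟨t, α * t ^ 2, t, ht0, rfl, ?_, fun u hu hu2 => ?_⟩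
  · -- `t² − α t² = t² (1 − α) ∈ (4)`, place by place
    refine mem_span_four_of_forall_intValuation_le _ fun u => ?_
    have hfac : t ^ 2 - α * t ^ 2 = t * (t * (1 - α)) := by ring
    rw [hfac, map_mul, map_mul]
    have ht1 : u.intValuation t ≤ 1 := HeightOneSpectrum.intValuation_le_one u t
    have hα1 : u.intValuation (1 - α) ≤ 1 := HeightOneSpectrum.intValuation_le_one u _
    by_cases hu2 : (2 : 𝓞 F) ∈ u.asIdeal
    · by_cases huv : u = v'
      · -- at `v′`: `|t| ≤ |4|`
        have htv : u.intValuation t ≤ u.intValuation (4 : 𝓞 F) := by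
          rw [← hmem_iff]
          have h := ht u ((hD u).2 hu2)
          rwa [if_pos huv, sub_zero] at h
        calc u.intValuation t * (u.intValuation t * u.intValuation (1 - α))
            ≤ u.intValuation (4 : 𝓞 F) * (1 * 1) := mul_le_mul' htv (mul_le_mul' ht1 hα1)
          _ = u.intValuation (4 : 𝓞 F) := by rw [mul_one, mul_one]
      · -- at another dyadic place: `|1 − α| ≤ |4|`
        have hαv : u.intValuation (1 - α) ≤ u.intValuation (4 : 𝓞 F) := by
          rw [← Valuation.map_neg, neg_sub]
          exact intValuation_sub_one_le_of_valuation_div_four_le u α (hα4 u huv hu2)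
        calc u.intValuation t * (u.intValuation t * u.intValuation (1 - α))
            ≤ 1 * (1 * u.intValuation (4 : 𝓞 F)) := mul_le_mul' ht1 (mul_le_mul' ht1 hαv)
          _ = u.intValuation (4 : 𝓞 F) := by rw [one_mul, one_mul]
    · -- off `2`: `|4|_u = 1`
      have h41 : u.intValuation (4 : 𝓞 F) = 1 := by
        refine HeightOneSpectrum.intValuation_eq_one_iff.2 fun h4 => hu2 ?_
        rw [show (4 : 𝓞 F) = 2 * 2 by norm_num] at h4
        rcases u.isPrime.mem_or_mem h4 with h | h <;> exact h
      rw [h41]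
      calc u.intValuation t * (u.intValuation t * u.intValuation (1 - α)) ≤ 1 * (1 * 1) := mul_le_mul' ht1 (mul_le_mul' ht1 hα1)
        _ = 1 := by rw [one_mul, one_mul]
  · -- `m₁ = α t² ∉ 𝔭_u` at a dyadic `u ≠ v′`: `t ≡ 1 (mod 𝔭_u)` and `α ∉ 𝔭_u`
    have ht1 : t - 1 ∈ u.asIdeal := by
      have h := ht u ((hD u).2 hu2)
      rw [if_neg hu] at h
      exact hnpos u hu2 h
    have htu : t ∉ u.asIdeal := fun htm => u.isPrime.ne_top ((Ideal.eq_top_iff_one _).2 (by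
      have := Ideal.sub_mem _ htm ht1
      rwa [sub_sub_cancel] at this))
    intro hm
    rcases u.isPrime.mem_or_mem hm with h | h
    · exact hαu2 u hu hu2 h
    · exact htu (u.isPrime.mem_of_pow_mem 2 h)

end PlantedTwo

end Summit.HodgeConjecture.HodgeConjecture.R90.S3

end
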